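import Literature.MathematicalPhysics.QuantumFieldTheory.Balaban1983to89.B6Eq230GaussianRoute
import Literature.MathematicalPhysics.QuantumFieldTheory.Balaban1983to89.B6Eq232GaussianMoment

/-!
# `Balaban1983to89.B6Eq233GaussianRoute` — T. Bałaban, *Propagators and renormalization transformations for lattice
# gauge theories. II*, Commun. Math. Phys. **96** (1984) 223–250 [Balaban1984PropagatorsII], Sect. A (2.33)–(2.34)
# pp. 227–228: the Faddeev–Popov computation (2.33) applied to the moment integral (2.32), and **(2.34)
# `R∂*GQ* = 0`, `QG∂R = 0` DERIVED BY THE PRINTED GAUSSIAN ROUTE**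

statement-level skeleton of published theorems with citation tags; proofs where landed; nothing here is a claim about the Yang–Mills mass gap

PDF held: `paper:balaban1984-cmp96-propagators-rt-ii` (journal page = PDF page + 222); pp. 227–228 read AS IMAGES on
the ×2 renders `run/shared/lean/pub/pub-balaban/b2b-balaban-ref1/pages/1984-cmp96-propagators-rt-II/…-p005, p006-x2.png`
by this seat (2026-08-21).

CITATION HEADER (lean-in-tree rule).  WHAT IS REPRODUCED: lit-balaban SKELETON row **B6.Eq2.34** ((2.32)–(2.34); head
`R∂*GQ* = 0`, `QG∂R = 0` = the ALGEBRAIC theorems of record `…B6Eq231.eq234_left` / `eq234_right`, p239491; census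
C-B6-2 *"Gaussian derivation absent"*).  File 4/4 of the printed Gaussian route by PHASE-2 seat p22 (gen 4); owner r03,
referee ref-4.  IMPORTS, restating nothing: `…B6Eq228FaddeevPopov` (gauge algebra), `…B6Eq230GaussianRoute`
(`fp_decomposition` = (2.29) with the two swaps and the gauge transformation; `exists_sliceEquiv`),
`…B6Eq232GaussianMoment` (`eq232` = (2.32)).

PRINT (pp. 227–228 [PDF 5–6], verbatim).  *"Now we consider the operator R∂*GQ*. We have
R∂*GQ* = Z⁻¹∫dA e^{−½⟨A,Δ_aA⟩} R∂*A QA. (2.32) Applying the same operations as in (2.28)–(2.30) we get,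
  R∂*GQ* = Z⁻¹|det(Δ↾_{N(Q′)})|Z′∫dA e^{−½‖∂A‖²−½a‖QA‖²}
     · δ_R(R∂*A)∫dλ′δ(Q′λ′)e^{−½‖∂*A−Δλ′‖²}(R∂*A − Δλ′)QA · (∫dλδ(Q′λ)e^{−½‖∂*A−Δλ‖²})⁻¹
   = Z⁻¹|det(Δ↾_{N(Q′)})|Z′∫dA e^{−½‖∂A‖²−½a‖QA‖²}δ_R(R∂*A)
     · ∫dλ′δ(Q′λ′)e^{−½‖Δλ′‖²}(−Δλ′ − Δ𝒢Δ∂*A)QA · (∫dλδ(Q′λ)e^{−½‖Δλ‖²})⁻¹ = 0.   (2.33)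
[p. 228] Hence we have R∂*GQ* = 0, QG∂R = 0. (2.34) The equalities (2.31), (2.34) are generalizations of the
equalities (1.97), (1.95) in [4]"*.

TYPING (as in files 1–3): (2.32)/(2.33) through matrix elements `⟨g, · u⟩`; `∫dλδ(Q′λ)` = an additive Haar measure `ν` on
`N` (= N(Q′)), reflection invariant (automatic: a regular additive Haar measure on an abelian group); the slice / orbit
data of (2.29) as in `…B6Eq230GaussianRoute` (`S, μS, s, e, he, hs`), DISCHARGED in `eq234_of_gaussian`.  The second line
of (2.33) writes `R∂*A` as `Δ𝒢Δ∂*A` ((2.26)); typed with `R` (the 𝒢-letters are a rewrite under (2.26), cf.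
`…B6Eq228FaddeevPopov.eq230_line3_calG`).  The vanishing: `∫dλ′δ(Q′λ′)e^{−½‖Δλ′‖²}Δλ′ = 0` (odd integrand) and
`Δ𝒢Δ∂*A = R∂*A = 0` on the support of `δ_R`.

CONTENTS (all theorems; no definitions; standard axioms).  `eq233_line1` (gauge transformation of the (2.32)-integrand
in its (2.28)₂ form), `eq233_line2` (expansion on the support of `δ_R`, translation in the denominator), `eq233_orbit_zero`
(the odd orbit integral vanishes), **`eq233`** (`∫dA e^{−½⟨A,Δ_aA⟩}⟨g,R∂*A⟩⟨QA,u⟩ = 0`, assembled by `fp_decomposition`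
and the factorisation slice × orbit — no integrability hypothesis), **`eq234_gaussian_left`** (`R∂*GQ* = 0` from (2.32) and
(2.33), `Z ≠ 0`), **`eq234_gaussian_right`** (`QG∂R = 0`, the adjoint), **`eq234_of_gaussian`** (both, slice/orbit data
discharged: hypotheses = the printed structure, Δ injective on N(Q′), `Z ≠ 0`); §4 `form_of_deltaA` / `deltaA_symm` /
**`eq231_234_deltaA`** — (2.31) ∧ (2.34) stated for THE PRINTED OPERATOR `Δ_a = Δ − ∂P∂* + Q*aQ` of (2.19)
(`…B6SectA.deltaA`, Δ = curl*curl + ∂∂*, P = I − R); `eq231_234_deltaA_of_pos` — the same under positivity of `Δ_a` alone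
(`Z ≠ 0` discharged by `Z_pos`).  HONEST SCOPE as in file 1/4.
Unit `lit-balaban-p22` (gen 4), HOME `run/shared/lean/pub/lit-balaban/`.
-/

noncomputable section

open MeasureTheory
open scoped InnerProductSpace

namespace Literature.MathematicalPhysics.QuantumFieldTheory.Balaban1983to89.B6Eq233GaussianRoute

open B6Eq228FaddeevPopov B6Eq230GaussianRoute B6Eq232GaussianMoment

/-! ## §1  (2.33), line by line -/

section Display233

variable {V A W T N : Type*} [NormedAddCommGroup V] [InnerProductSpace ℝ V] [NormedAddCommGroup A]
  [InnerProductSpace ℝ A] [NormedAddCommGroup W] [InnerProductSpace ℝ W]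
  [NormedAddCommGroup T] [InnerProductSpace ℝ T] [AddCommGroup N] [Module ℝ N] [MeasurableSpace N]

/-- **(2.33), first line** (the operations of (2.28)–(2.30) applied to the integrand of (2.32): Gaussian gauge-fixing
unit (2.24), gauge transformation `A → A − ∂λ′`):
`[w(·)e^{−½‖∂*·‖²}Z′(∫dλδ(Q′λ)e^{−½‖∂*·−Δλ‖²})⁻¹⟨g,R∂*·⟩⟨Q·,u⟩](A^{λ′})
 = w(A) · e^{−½‖∂*A−Δλ′‖²} ⟨g, R∂*A−Δλ′⟩ Z′ (∫dλδ(Q′λ)e^{−½‖∂*A−Δλ′−Δλ‖²})⁻¹ · ⟨QA,u⟩`, `w = e^{−½‖∂·‖²−½⟨Q·,aQ·⟩}`.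
[cite: Balaban1984PropagatorsII, (2.33) p.227] -/
theorem eq233_line1 (ν : Measure N) (curl : A →ₗ[ℝ] T) (dstar : A →ₗ[ℝ] V) (Rp : V →ₗ[ℝ] V)
    (Q : A →ₗ[ℝ] W) (a : W →ₗ[ℝ] W) (D : N →ₗ[ℝ] V) (dN : N →ₗ[ℝ] A) (K : Submodule ℝ V)
    [K.HasOrthogonalProjection] (hK : LinearMap.range D = K) (hR : ∀ g, Rp g = K.starProjection g)
    (hcurl : ∀ l, curl (dN l) = 0) (hQ : ∀ l, Q (dN l) = 0) (hD : ∀ l, dstar (dN l) = D l) (Z' : ℝ) (g : V)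
    (u : W) (v : A) (l' : N) :
    Real.exp (-(1 / 2) * ‖curl (v - dN l')‖ ^ 2 - (1 / 2) * ⟪Q (v - dN l'), a (Q (v - dN l'))⟫_ℝ) *
        (Real.exp (-(1 / 2) * ‖dstar (v - dN l')‖ ^ 2) * Z' *
          (∫ l, Real.exp (-(1 / 2) * ‖dstar (v - dN l') - D l‖ ^ 2) ∂ν)⁻¹) *
        (⟪g, Rp (dstar (v - dN l'))⟫_ℝ * ⟪Q (v - dN l'), u⟫_ℝ) =
      Real.exp (-(1 / 2) * ‖curl v‖ ^ 2 - (1 / 2) * ⟪Q v, a (Q v)⟫_ℝ) *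
        (Real.exp (-(1 / 2) * ‖dstar v - D l'‖ ^ 2) * ⟪g, Rp (dstar v) - D l'⟫_ℝ * Z' *
          (∫ l, Real.exp (-(1 / 2) * ‖dstar v - D l' - D l‖ ^ 2) ∂ν)⁻¹) * ⟪Q v, u⟫_ℝ := by
  rw [R_dstar_gauge D K hK Rp hR dstar dN hD v l', map_sub curl, hcurl, sub_zero, map_sub Q, hQ, sub_zero,
    map_sub dstar, hD]
  ring

variable [MeasurableAdd N]

/-- **(2.33), second line (on the support of `δ_R(R∂*A)`):** integrating the `λ′`-factor of line 1 over the orbit,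
with the translation by the mean (`λ → λ − λ′` in the denominator; on the slice `⟨∂*A,Δλ′⟩ = 0`, so the factors
`e^{−½‖∂*A‖²}` cancel):
`∫dλ′δ(Q′λ′)e^{−½‖∂*A−Δλ′‖²}⟨g,R∂*A−Δλ′⟩ · Z′(∫dλδ(Q′λ)e^{−½‖∂*A−Δλ′−Δλ‖²})⁻¹
 = ∫dλ′δ(Q′λ′)e^{−½‖Δλ′‖²}⟨g, −Δλ′ − Δ𝒢Δ∂*A⟩ · Z′(∫dλδ(Q′λ)e^{−½‖Δλ‖²})⁻¹` with `Δ𝒢Δ∂*A = R∂*A` ((2.26)).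
[cite: Balaban1984PropagatorsII, (2.33) p.227] -/
theorem eq233_line2 (ν : Measure N) [ν.IsAddLeftInvariant] (dstar : A →ₗ[ℝ] V) (Rp : V →ₗ[ℝ] V)
    (D : N →ₗ[ℝ] V) (K : Submodule ℝ V) [K.HasOrthogonalProjection] (hK : LinearMap.range D = K)
    (hR : ∀ g, Rp g = K.starProjection g) {v : A} (hs : Rp (dstar v) = 0) (Z' : ℝ) (g : V) :
    ∫ l', Real.exp (-(1 / 2) * ‖dstar v - D l'‖ ^ 2) * ⟪g, Rp (dstar v) - D l'⟫_ℝ * Z' *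
        (∫ l, Real.exp (-(1 / 2) * ‖dstar v - D l' - D l‖ ^ 2) ∂ν)⁻¹ ∂ν =
      ∫ l', Real.exp (-(1 / 2) * ‖D l'‖ ^ 2) * ⟪g, -D l' - Rp (dstar v)⟫_ℝ * Z' *
        (∫ l, Real.exp (-(1 / 2) * ‖D l‖ ^ 2) ∂ν)⁻¹ ∂ν := by
  refine integral_congr_ae (ae_of_all _ fun l' => ?_)
  -- translation in the denominator and the Pythagorean split on the slice
  have htr : ∫ l, Real.exp (-(1 / 2) * ‖dstar v - D l' - D l‖ ^ 2) ∂ν =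
      ∫ l, Real.exp (-(1 / 2) * ‖dstar v - D l‖ ^ 2) ∂ν := by
    have h : (fun l => Real.exp (-(1 / 2) * ‖dstar v - D l' - D l‖ ^ 2)) =
        fun l => (fun l'' => Real.exp (-(1 / 2) * ‖dstar v - D l''‖ ^ 2)) (l' + l) := by
      funext l; simp only [map_add, sub_sub]
    rw [h]
    exact integral_add_left_eq_self (fun l'' => Real.exp (-(1 / 2) * ‖dstar v - D l''‖ ^ 2)) l'
  have hsq : ∀ l, ‖dstar v - D l‖ ^ 2 = ‖dstar v‖ ^ 2 + ‖D l‖ ^ 2 := by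
    intro l
    rw [norm_sub_sq_real, inner_dstar_D_of_slice D K hK Rp hR hs l]; ring
  have hden : ∫ l, Real.exp (-(1 / 2) * ‖dstar v - D l‖ ^ 2) ∂ν =
      Real.exp (-(1 / 2) * ‖dstar v‖ ^ 2) * ∫ l, Real.exp (-(1 / 2) * ‖D l‖ ^ 2) ∂ν := by
    rw [← integral_const_mul]
    congr 1; funext l
    rw [← Real.exp_add, hsq]; congr 1; ring
  simp only
  rw [htr, hden, hsq, hs, zero_sub, sub_zero, mul_inv]
  have hne : Real.exp (-(1 / 2) * ‖dstar v‖ ^ 2) ≠ 0 := Real.exp_ne_zero _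
  rw [show Real.exp (-(1 / 2) * (‖dstar v‖ ^ 2 + ‖D l'‖ ^ 2)) =
      Real.exp (-(1 / 2) * ‖dstar v‖ ^ 2) * Real.exp (-(1 / 2) * ‖D l'‖ ^ 2) by
    rw [← Real.exp_add]; congr 1; ring]
  field_simp

omit [MeasurableAdd N] in
/-- On the support of `δ_R(R∂*A)` the orbit integral of (2.33)'s second line VANISHES: the Gaussian
`e^{−½‖Δλ′‖²}` is even and `⟨g, Δλ′⟩` odd (`dλ′` reflection invariant), and `Δ𝒢Δ∂*A = R∂*A = 0` — *"= 0. (2.33)"*.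
[cite: Balaban1984PropagatorsII, (2.33) p.227] -/
theorem eq233_orbit_zero [MeasurableNeg N] (ν : Measure N) [ν.IsNegInvariant] (dstar : A →ₗ[ℝ] V)
    (Rp : V →ₗ[ℝ] V) (D : N →ₗ[ℝ] V) {v : A} (hs : Rp (dstar v) = 0) (Z' : ℝ) (g : V) :
    ∫ l', Real.exp (-(1 / 2) * ‖D l'‖ ^ 2) * ⟪g, -D l' - Rp (dstar v)⟫_ℝ * Z' *
        (∫ l, Real.exp (-(1 / 2) * ‖D l‖ ^ 2) ∂ν)⁻¹ ∂ν = 0 := by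
  rw [hs]
  simp only [sub_zero, inner_neg_right]
  have h := integral_neg_eq_self
    (fun l' => Real.exp (-(1 / 2) * ‖D l'‖ ^ 2) * -⟪g, D l'⟫_ℝ * Z' *
      (∫ l, Real.exp (-(1 / 2) * ‖D l‖ ^ 2) ∂ν)⁻¹) ν
  simp only [map_neg, norm_neg, inner_neg_right, neg_neg] at h
  have h2 : ∫ l', Real.exp (-(1 / 2) * ‖D l'‖ ^ 2) * ⟪g, D l'⟫_ℝ * Z' *
      (∫ l, Real.exp (-(1 / 2) * ‖D l‖ ^ 2) ∂ν)⁻¹ ∂ν =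
      -∫ l', Real.exp (-(1 / 2) * ‖D l'‖ ^ 2) * -⟪g, D l'⟫_ℝ * Z' *
        (∫ l, Real.exp (-(1 / 2) * ‖D l‖ ^ 2) ∂ν)⁻¹ ∂ν := by
    rw [← integral_neg]; congr 1; funext l'; ring
  linarith

end Display233

/-! ## §2  (2.33) = 0 assembled and (2.34) -/

section Assembly234

variable {V A W T S N : Type*} [NormedAddCommGroup V] [InnerProductSpace ℝ V]
  [NormedAddCommGroup A] [InnerProductSpace ℝ A] [FiniteDimensional ℝ A] [MeasurableSpace A] [BorelSpace A]
  [NormedAddCommGroup W] [InnerProductSpace ℝ W] [NormedAddCommGroup T] [InnerProductSpace ℝ T]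
  [NormedAddCommGroup S] [NormedSpace ℝ S] [FiniteDimensional ℝ S] [MeasurableSpace S] [BorelSpace S]
  [NormedAddCommGroup N] [NormedSpace ℝ N] [FiniteDimensional ℝ N] [MeasurableSpace N] [BorelSpace N]

/-- **(2.33) = 0, assembled:** `∫dA e^{−½⟨A,Δ_aA⟩}⟨g,R∂*A⟩⟨QA,u⟩ = 0` — Faddeev–Popov decomposition of `dA` ((2.29)),
gauge invariance of `‖∂A‖²`, `QA`, and the vanishing odd orbit integral. [cite: Balaban1984PropagatorsII, (2.33) p.227] -/
theorem eq233 (μS : Measure S) (ν : Measure N) (μA : Measure A) [μS.IsAddHaarMeasure]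
    [ν.IsAddHaarMeasure] [μA.IsAddHaarMeasure] (e : (S × N) ≃L[ℝ] A) (s : S →ₗ[ℝ] A) (dN : N →ₗ[ℝ] A)
    (he : ∀ m l, e (m, l) = s m - dN l) (M : A →ₗ[ℝ] A) (curl : A →ₗ[ℝ] T) (dstar : A →ₗ[ℝ] V)
    (Rp : V →ₗ[ℝ] V) (Q : A →ₗ[ℝ] W) (a : W →ₗ[ℝ] W) (D : N →ₗ[ℝ] V) (K : Submodule ℝ V)
    [K.HasOrthogonalProjection] (hK : LinearMap.range D = K) (hR : ∀ g, Rp g = K.starProjection g)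
    (hform : ∀ v, ⟪v, M v⟫_ℝ = ‖curl v‖ ^ 2 + ⟪dstar v, Rp (dstar v)⟫_ℝ + ⟪Q v, a (Q v)⟫_ℝ)
    (hcurl : ∀ l, curl (dN l) = 0) (hQ : ∀ l, Q (dN l) = 0) (hD : ∀ l, dstar (dN l) = D l)
    (hs : ∀ m, Rp (dstar (s m)) = 0) (g : V) (u : W) :
    ∫ v, Real.exp (-(1 / 2) * ⟪v, M v⟫_ℝ) * (⟪g, Rp (dstar v)⟫_ℝ * ⟪Q v, u⟫_ℝ) ∂μA = 0 := by
  haveI : ν.IsNegInvariant := inferInstance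
  set c : ℝ := (Measure.addHaarScalarFactor ((μS.prod ν).map e) μA : ℝ) with hc
  have hcpos : 0 < c := by rw [hc]; exact_mod_cast B5ChangeOfGauge123.jacobian_pos μS ν μA e
  have h1 : c * ∫ v, Real.exp (-(1 / 2) * ⟪v, M v⟫_ℝ) * (⟪g, Rp (dstar v)⟫_ℝ * ⟪Q v, u⟫_ℝ) ∂μA = 0 := by
    rw [hc, ← fp_decomposition μS ν μA e s dN he]
    have hpt : ∀ p : S × N, Real.exp (-(1 / 2) * ⟪s p.1 - dN p.2, M (s p.1 - dN p.2)⟫_ℝ) *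
        (⟪g, Rp (dstar (s p.1 - dN p.2))⟫_ℝ * ⟪Q (s p.1 - dN p.2), u⟫_ℝ) =
        (Real.exp (-(1 / 2) * ‖curl (s p.1)‖ ^ 2 - (1 / 2) * ⟪Q (s p.1), a (Q (s p.1))⟫_ℝ) * ⟪Q (s p.1), u⟫_ℝ) *
          (Real.exp (-(1 / 2) * ‖D p.2‖ ^ 2) * -⟪g, D p.2⟫_ℝ) := by
      intro p
      rw [form_gauge M curl dstar Rp Q a D dN K hK hR hform hcurl hQ hD (hs p.1) p.2,
        R_dstar_gauge D K hK Rp hR dstar dN hD (s p.1) p.2, hs, zero_sub, inner_neg_right, map_sub Q, hQ, sub_zero]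
      rw [show Real.exp (-(1 / 2) * (‖curl (s p.1)‖ ^ 2 + ⟪Q (s p.1), a (Q (s p.1))⟫_ℝ + ‖D p.2‖ ^ 2)) =
          Real.exp (-(1 / 2) * ‖curl (s p.1)‖ ^ 2 - (1 / 2) * ⟪Q (s p.1), a (Q (s p.1))⟫_ℝ) *
            Real.exp (-(1 / 2) * ‖D p.2‖ ^ 2) by rw [← Real.exp_add]; congr 1; ring]
      ring
    simp_rw [hpt]
    rw [integral_prod_mul (fun m : S => Real.exp (-(1 / 2) * ‖curl (s m)‖ ^ 2 - (1 / 2) * ⟪Q (s m), a (Q (s m))⟫_ℝ) *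
      ⟪Q (s m), u⟫_ℝ) (fun l : N => Real.exp (-(1 / 2) * ‖D l‖ ^ 2) * -⟪g, D l⟫_ℝ)]
    -- the odd orbit integral vanishes
    have hodd : ∫ l, Real.exp (-(1 / 2) * ‖D l‖ ^ 2) * -⟪g, D l⟫_ℝ ∂ν = 0 := by
      have h := integral_neg_eq_self (fun l => Real.exp (-(1 / 2) * ‖D l‖ ^ 2) * -⟪g, D l⟫_ℝ) ν
      simp only [map_neg, norm_neg, inner_neg_right, neg_neg] at h
      have h2 : ∫ l, Real.exp (-(1 / 2) * ‖D l‖ ^ 2) * ⟪g, D l⟫_ℝ ∂ν =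
          -∫ l, Real.exp (-(1 / 2) * ‖D l‖ ^ 2) * -⟪g, D l⟫_ℝ ∂ν := by
        rw [← integral_neg]; congr 1; funext l; ring
      linarith
    rw [hodd, mul_zero]
  rcases mul_eq_zero.mp h1 with h | h
  · exact absurd h hcpos.ne'
  · exact h

/-- **(2.34), first identity, DERIVED BY THE PRINTED GAUSSIAN ROUTE: `R∂*GQ* = 0`** — from (2.32) and (2.33) = 0,
`Z ≠ 0`.  Same operator shape as the algebraic theorem of record `…B6Eq231.eq234_left`.
[cite: Balaban1984PropagatorsII, (2.34) p.228] -/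
theorem eq234_gaussian_left (μS : Measure S) (ν : Measure N) (μA : Measure A) [μS.IsAddHaarMeasure]
    [ν.IsAddHaarMeasure] [μA.IsAddHaarMeasure] (e : (S × N) ≃L[ℝ] A) (s : S →ₗ[ℝ] A) (dN : N →ₗ[ℝ] A)
    (he : ∀ m l, e (m, l) = s m - dN l) (M G : A →ₗ[ℝ] A) (curl : A →ₗ[ℝ] T) (d : V →ₗ[ℝ] A)
    (dstar : A →ₗ[ℝ] V) (Rp : V →ₗ[ℝ] V) (Q : A →ₗ[ℝ] W) (Qs : W →ₗ[ℝ] A) (a : W →ₗ[ℝ] W) (D : N →ₗ[ℝ] V)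
    (K : Submodule ℝ V) [K.HasOrthogonalProjection] (hK : LinearMap.range D = K)
    (hR : ∀ g, Rp g = K.starProjection g) (hadj : ∀ (v : A) (g : V), ⟪v, d g⟫_ℝ = ⟪dstar v, g⟫_ℝ)
    (hQadj : ∀ (w : W) (v : A), ⟪Qs w, v⟫_ℝ = ⟪w, Q v⟫_ℝ)
    (hM : ∀ x y : A, ⟪M x, y⟫_ℝ = ⟪x, M y⟫_ℝ) (hMG : M ∘ₗ G = LinearMap.id)
    (hform : ∀ v, ⟪v, M v⟫_ℝ = ‖curl v‖ ^ 2 + ⟪dstar v, Rp (dstar v)⟫_ℝ + ⟪Q v, a (Q v)⟫_ℝ)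
    (hcurl : ∀ l, curl (dN l) = 0) (hQ : ∀ l, Q (dN l) = 0) (hD : ∀ l, dstar (dN l) = D l)
    (hs : ∀ m, Rp (dstar (s m)) = 0) (hZ : ∫ v, Real.exp (-(1 / 2) * ⟪v, M v⟫_ℝ) ∂μA ≠ 0) :
    Rp ∘ₗ dstar ∘ₗ G ∘ₗ Qs = 0 := by
  haveI : μA.IsNegInvariant := inferInstance
  have hint : Integrable (fun v => Real.exp (-(1 / 2) * ⟪v, M v⟫_ℝ)) μA := by
    by_contra h; exact hZ (integral_undef h)
  have hzero : ∀ g u, ⟪g, (Rp ∘ₗ dstar ∘ₗ G ∘ₗ Qs) u⟫_ℝ = 0 := by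
    intro g u
    have h := eq232 μA M G d dstar Rp Q Qs K hR hadj hQadj hM hMG hint g u
    rw [eq233 μS ν μA e s dN he M curl dstar Rp Q a D K hK hR hform hcurl hQ hD hs g u] at h
    rcases mul_eq_zero.mp h with h' | h'
    · exact absurd h' hZ
    · exact h'
  ext u
  simpa using hzero ((Rp ∘ₗ dstar ∘ₗ G ∘ₗ Qs) u) u

/-- **(2.34), second identity: `QG∂R = 0`** — the adjoint of the first (`G` symmetric, `∂*`/`∂` and `Q*`/`Q` adjoint
pairs, `R` symmetric).  Same shape as `…B6Eq231.eq234_right`. [cite: Balaban1984PropagatorsII, (2.34) p.228] -/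
theorem eq234_gaussian_right (μS : Measure S) (ν : Measure N) (μA : Measure A) [μS.IsAddHaarMeasure]
    [ν.IsAddHaarMeasure] [μA.IsAddHaarMeasure] (e : (S × N) ≃L[ℝ] A) (s : S →ₗ[ℝ] A) (dN : N →ₗ[ℝ] A)
    (he : ∀ m l, e (m, l) = s m - dN l) (M G : A →ₗ[ℝ] A) (curl : A →ₗ[ℝ] T) (d : V →ₗ[ℝ] A)
    (dstar : A →ₗ[ℝ] V) (Rp : V →ₗ[ℝ] V) (Q : A →ₗ[ℝ] W) (Qs : W →ₗ[ℝ] A) (a : W →ₗ[ℝ] W) (D : N →ₗ[ℝ] V)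
    (K : Submodule ℝ V) [K.HasOrthogonalProjection] (hK : LinearMap.range D = K)
    (hR : ∀ g, Rp g = K.starProjection g) (hadj : ∀ (v : A) (g : V), ⟪v, d g⟫_ℝ = ⟪dstar v, g⟫_ℝ)
    (hQadj : ∀ (w : W) (v : A), ⟪Qs w, v⟫_ℝ = ⟪w, Q v⟫_ℝ)
    (hM : ∀ x y : A, ⟪M x, y⟫_ℝ = ⟪x, M y⟫_ℝ) (hMG : M ∘ₗ G = LinearMap.id)
    (hform : ∀ v, ⟪v, M v⟫_ℝ = ‖curl v‖ ^ 2 + ⟪dstar v, Rp (dstar v)⟫_ℝ + ⟪Q v, a (Q v)⟫_ℝ)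
    (hcurl : ∀ l, curl (dN l) = 0) (hQ : ∀ l, Q (dN l) = 0) (hD : ∀ l, dstar (dN l) = D l)
    (hs : ∀ m, Rp (dstar (s m)) = 0) (hZ : ∫ v, Real.exp (-(1 / 2) * ⟪v, M v⟫_ℝ) ∂μA ≠ 0) :
    Q ∘ₗ G ∘ₗ d ∘ₗ Rp = 0 := by
  have hL := eq234_gaussian_left μS ν μA e s dN he M G curl d dstar Rp Q Qs a D K hK hR hadj hQadj hM hMG hform
    hcurl hQ hD hs hZ
  ext x
  apply ext_inner_right ℝ
  intro u
  have h0 : Rp (dstar (G (Qs u))) = 0 := by simpa using LinearMap.congr_fun hL u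
  simp only [LinearMap.coe_comp, Function.comp_apply, LinearMap.zero_apply, inner_zero_left]
  calc ⟪Q (G (d (Rp x))), u⟫_ℝ = ⟪G (d (Rp x)), Qs u⟫_ℝ := by rw [real_inner_comm, ← hQadj, real_inner_comm]
    _ = ⟪d (Rp x), G (Qs u)⟫_ℝ := G_symm M G hM hMG _ _
    _ = ⟪G (Qs u), d (Rp x)⟫_ℝ := real_inner_comm _ _
    _ = ⟪dstar (G (Qs u)), Rp x⟫_ℝ := hadj _ _
    _ = ⟪Rp (dstar (G (Qs u))), x⟫_ℝ := by rw [R_symm K Rp hR]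
    _ = 0 := by rw [h0, inner_zero_left]

end Assembly234

/-! ## §3  (2.34) with the slice ⊕ orbit data discharged -/

section Headline

variable {V A W T N : Type*} [NormedAddCommGroup V] [InnerProductSpace ℝ V]
  [NormedAddCommGroup A] [InnerProductSpace ℝ A] [FiniteDimensional ℝ A] [MeasurableSpace A] [BorelSpace A]
  [NormedAddCommGroup W] [InnerProductSpace ℝ W] [NormedAddCommGroup T] [InnerProductSpace ℝ T]
  [NormedAddCommGroup N] [NormedSpace ℝ N] [FiniteDimensional ℝ N]

/-- **(2.34) `R∂*GQ* = 0`, `QG∂R = 0` by the Gaussian route, data discharged as in `eq231_of_gaussian`.**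
[cite: Balaban1984PropagatorsII, (2.34) p.228] -/
theorem eq234_of_gaussian (μA : Measure A) [μA.IsAddHaarMeasure] (M G : A →ₗ[ℝ] A) (curl : A →ₗ[ℝ] T)
    (d : V →ₗ[ℝ] A) (dstar : A →ₗ[ℝ] V) (Rp : V →ₗ[ℝ] V) (Q : A →ₗ[ℝ] W) (Qs : W →ₗ[ℝ] A) (a : W →ₗ[ℝ] W)
    (D : N →ₗ[ℝ] V) (dN : N →ₗ[ℝ] A) (K : Submodule ℝ V) [K.HasOrthogonalProjection]
    (hK : LinearMap.range D = K) (hR : ∀ g, Rp g = K.starProjection g)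
    (hadj : ∀ (v : A) (g : V), ⟪v, d g⟫_ℝ = ⟪dstar v, g⟫_ℝ) (hQadj : ∀ (w : W) (v : A), ⟪Qs w, v⟫_ℝ = ⟪w, Q v⟫_ℝ)
    (hM : ∀ x y : A, ⟪M x, y⟫_ℝ = ⟪x, M y⟫_ℝ) (hMG : M ∘ₗ G = LinearMap.id)
    (hform : ∀ v, ⟪v, M v⟫_ℝ = ‖curl v‖ ^ 2 + ⟪dstar v, Rp (dstar v)⟫_ℝ + ⟪Q v, a (Q v)⟫_ℝ)
    (hcurl : ∀ l, curl (dN l) = 0) (hQ : ∀ l, Q (dN l) = 0) (hD : ∀ l, dstar (dN l) = D l)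
    (hDinj : Function.Injective D) (hZ : ∫ v, Real.exp (-(1 / 2) * ⟪v, M v⟫_ℝ) ∂μA ≠ 0) :
    Rp ∘ₗ dstar ∘ₗ G ∘ₗ Qs = 0 ∧ Q ∘ₗ G ∘ₗ d ∘ₗ Rp = 0 := by
  borelize N
  obtain ⟨e, he⟩ := exists_sliceEquiv dstar Rp D dN K hK hR hD hDinj
  exact ⟨eq234_gaussian_left (Measure.addHaar) (Measure.addHaar) μA e (LinearMap.ker (Rp ∘ₗ dstar)).subtype dN
      he M G curl d dstar Rp Q Qs a D K hK hR hadj hQadj hM hMG hform hcurl hQ hD (fun m => LinearMap.map_coe_ker (Rp ∘ₗ dstar) m) hZ,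
    eq234_gaussian_right (Measure.addHaar) (Measure.addHaar) μA e (LinearMap.ker (Rp ∘ₗ dstar)).subtype dN
      he M G curl d dstar Rp Q Qs a D K hK hR hadj hQadj hM hMG hform hcurl hQ hD (fun m => LinearMap.map_coe_ker (Rp ∘ₗ dstar) m) hZ⟩

end Headline

/-! ## §4  The printed operator `Δ_a` of (2.19): `…B6SectA.deltaA` satisfies the form hypothesis; (2.31) ∧ (2.34) for it -/

section DeltaA

variable {V A W T N : Type*} [NormedAddCommGroup V] [InnerProductSpace ℝ V]
  [NormedAddCommGroup A] [InnerProductSpace ℝ A] [NormedAddCommGroup W] [InnerProductSpace ℝ W]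
  [NormedAddCommGroup T] [InnerProductSpace ℝ T]

/-- **(2.19) as a quadratic form:** for `Δ_a = Δ − ∂P∂* + Q*aQ` (`…B6SectA.deltaA`) with `Δ = ∂*∂ + ∂∂*` on vector fields
(the curl part `∂*∂ = curl*∘curl`), `P = I − R`, `∂*`/`∂`, `curl*`/`curl`, `Q*`/`Q` adjoint pairs:
`⟨A,Δ_aA⟩ = ‖∂A‖² + ⟨∂*A,R∂*A⟩ + ⟨QA,aQA⟩` — i.e. *"Δ_a = ∂*∂ + ∂R∂* + Q*aQ = Δ − ∂P∂* + Q*aQ (2.19)"* — the hypothesis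
`hform` of files 1–4. [cite: Balaban1984PropagatorsII, (2.19) p.226] -/
theorem form_of_deltaA (lap : A →ₗ[ℝ] A) (curl : A →ₗ[ℝ] T) (curlAdj : T →ₗ[ℝ] A) (d : V →ₗ[ℝ] A)
    (dstar : A →ₗ[ℝ] V) (Rp P : V →ₗ[ℝ] V) (Q : A →ₗ[ℝ] W) (Qs : W →ₗ[ℝ] A) (a : W →ₗ[ℝ] W)
    (hlap : lap = curlAdj ∘ₗ curl + d ∘ₗ dstar) (hP : P = LinearMap.id - Rp)
    (hcurlAdj : ∀ (t : T) (v : A), ⟪curlAdj t, v⟫_ℝ = ⟪t, curl v⟫_ℝ)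
    (hadj : ∀ (v : A) (g : V), ⟪v, d g⟫_ℝ = ⟪dstar v, g⟫_ℝ) (hQadj : ∀ (w : W) (v : A), ⟪Qs w, v⟫_ℝ = ⟪w, Q v⟫_ℝ)
    (v : A) :
    ⟪v, B6SectA.deltaA lap d dstar P Q Qs a v⟫_ℝ = ‖curl v‖ ^ 2 + ⟪dstar v, Rp (dstar v)⟫_ℝ + ⟪Q v, a (Q v)⟫_ℝ := by
  subst hlap hP
  simp only [B6SectA.deltaA, LinearMap.sub_apply, LinearMap.add_apply, LinearMap.coe_comp, Function.comp_apply,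
    LinearMap.id_apply, inner_sub_right, inner_add_right, map_sub]
  rw [real_inner_comm (curlAdj (curl v)), hcurlAdj, real_inner_self_eq_norm_sq, hadj, hadj,
    real_inner_comm (Qs (a (Q v))), hQadj, ← real_inner_comm (a (Q v)) (Q v)]
  ring

/-- `Δ_a` of (2.19) is symmetric (`R`, `a` symmetric; adjoint pairs as above). [cite: Balaban1984PropagatorsII, (2.19) p.226] -/
theorem deltaA_symm (lap : A →ₗ[ℝ] A) (curl : A →ₗ[ℝ] T) (curlAdj : T →ₗ[ℝ] A) (d : V →ₗ[ℝ] A)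
    (dstar : A →ₗ[ℝ] V) (Rp P : V →ₗ[ℝ] V) (Q : A →ₗ[ℝ] W) (Qs : W →ₗ[ℝ] A) (a : W →ₗ[ℝ] W) (K : Submodule ℝ V)
    [K.HasOrthogonalProjection] (hR : ∀ g, Rp g = K.starProjection g)
    (hlap : lap = curlAdj ∘ₗ curl + d ∘ₗ dstar) (hP : P = LinearMap.id - Rp)
    (hcurlAdj : ∀ (t : T) (v : A), ⟪curlAdj t, v⟫_ℝ = ⟪t, curl v⟫_ℝ)
    (hadj : ∀ (v : A) (g : V), ⟪v, d g⟫_ℝ = ⟪dstar v, g⟫_ℝ) (hQadj : ∀ (w : W) (v : A), ⟪Qs w, v⟫_ℝ = ⟪w, Q v⟫_ℝ)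
    (ha : ∀ w w' : W, ⟪a w, w'⟫_ℝ = ⟪w, a w'⟫_ℝ) (x y : A) :
    ⟪B6SectA.deltaA lap d dstar P Q Qs a x, y⟫_ℝ = ⟪x, B6SectA.deltaA lap d dstar P Q Qs a y⟫_ℝ := by
  subst hlap hP
  simp only [B6SectA.deltaA, LinearMap.sub_apply, LinearMap.add_apply, LinearMap.coe_comp, Function.comp_apply,
    LinearMap.id_apply, inner_sub_right, inner_add_right, inner_sub_left, inner_add_left, map_sub]
  have e1 : ⟪curlAdj (curl x), y⟫_ℝ = ⟪x, curlAdj (curl y)⟫_ℝ := by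
    rw [hcurlAdj, real_inner_comm (curlAdj (curl y)), hcurlAdj, real_inner_comm]
  have e2 : ⟪d (dstar x), y⟫_ℝ = ⟪x, d (dstar y)⟫_ℝ := by
    rw [real_inner_comm y (d (dstar x)), hadj, hadj]
    exact real_inner_comm _ _
  have e3 : ⟪d (Rp (dstar x)), y⟫_ℝ = ⟪x, d (Rp (dstar y))⟫_ℝ := by
    rw [real_inner_comm y (d (Rp (dstar x))), hadj, hadj, ← R_symm K Rp hR (dstar x) (dstar y)]
    exact real_inner_comm _ _
  have e4 : ⟪Qs (a (Q x)), y⟫_ℝ = ⟪x, Qs (a (Q y))⟫_ℝ := by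
    rw [hQadj, real_inner_comm (Qs (a (Q y))), hQadj, ha, real_inner_comm]
  rw [e1, e2, e3, e4]

variable [FiniteDimensional ℝ A] [MeasurableSpace A] [BorelSpace A] [NormedAddCommGroup N] [NormedSpace ℝ N]
  [FiniteDimensional ℝ N]

/-- **(2.31) and (2.34) FOR THE PRINTED `Δ_a` OF (2.19), by the Gaussian route (2.28)–(2.33):** with
`Δ_a = Δ − ∂P∂* + Q*aQ` (`…B6SectA.deltaA`; Δ = curl*curl + ∂∂*, P = I − R), `G = Δ_a⁻¹` ((2.22): `Δ_aG = I`), `R` the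
orthogonal projection onto `ΔN(Q′)` ((2.10)), Δ injective on `N(Q′)` ((2.11)), `∂∂λ = 0` and `Q∂λ = 0` for `λ ∈ N(Q′)`
((2.6)–(2.7)), `a` symmetric, and the Gaussian `Z = ∫dA e^{−½⟨A,Δ_aA⟩}` non-zero (positivity of `Δ_a`,
`…B6Eq230GaussianRoute.Z_pos`): `R∂*G∂R = R`, `R∂*GQ* = 0`, `QG∂R = 0`.
[cite: Balaban1984PropagatorsII, (2.31)–(2.34) pp.227–228] -/
theorem eq231_234_deltaA (μA : Measure A) [μA.IsAddHaarMeasure] (lap G : A →ₗ[ℝ] A) (curl : A →ₗ[ℝ] T)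
    (curlAdj : T →ₗ[ℝ] A) (d : V →ₗ[ℝ] A) (dstar : A →ₗ[ℝ] V) (Rp P : V →ₗ[ℝ] V) (Q : A →ₗ[ℝ] W) (Qs : W →ₗ[ℝ] A)
    (a : W →ₗ[ℝ] W) (D : N →ₗ[ℝ] V) (dN : N →ₗ[ℝ] A) (K : Submodule ℝ V) [K.HasOrthogonalProjection]
    (hK : LinearMap.range D = K) (hR : ∀ g, Rp g = K.starProjection g)
    (hlap : lap = curlAdj ∘ₗ curl + d ∘ₗ dstar) (hP : P = LinearMap.id - Rp)
    (hcurlAdj : ∀ (t : T) (v : A), ⟪curlAdj t, v⟫_ℝ = ⟪t, curl v⟫_ℝ)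
    (hadj : ∀ (v : A) (g : V), ⟪v, d g⟫_ℝ = ⟪dstar v, g⟫_ℝ) (hQadj : ∀ (w : W) (v : A), ⟪Qs w, v⟫_ℝ = ⟪w, Q v⟫_ℝ)
    (ha : ∀ w w' : W, ⟪a w, w'⟫_ℝ = ⟪w, a w'⟫_ℝ)
    (hG : B6SectA.deltaA lap d dstar P Q Qs a ∘ₗ G = LinearMap.id)
    (hcurl : ∀ l, curl (dN l) = 0) (hQ : ∀ l, Q (dN l) = 0) (hD : ∀ l, dstar (dN l) = D l)
    (hDinj : Function.Injective D)
    (hZ : ∫ v, Real.exp (-(1 / 2) * ⟪v, B6SectA.deltaA lap d dstar P Q Qs a v⟫_ℝ) ∂μA ≠ 0) :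
    Rp ∘ₗ dstar ∘ₗ G ∘ₗ d ∘ₗ Rp = Rp ∧ Rp ∘ₗ dstar ∘ₗ G ∘ₗ Qs = 0 ∧ Q ∘ₗ G ∘ₗ d ∘ₗ Rp = 0 := by
  have hform := form_of_deltaA lap curl curlAdj d dstar Rp P Q Qs a hlap hP hcurlAdj hadj hQadj
  have hM := deltaA_symm lap curl curlAdj d dstar Rp P Q Qs a K hR hlap hP hcurlAdj hadj hQadj ha
  exact ⟨eq231_of_gaussian μA _ G curl d dstar Rp Q a D dN K hK hR hadj hM hG hform hcurl hQ hD hDinj hZ,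
    eq234_of_gaussian μA _ G curl d dstar Rp Q Qs a D dN K hK hR hadj hQadj hM hG hform hcurl hQ hD hDinj hZ⟩

/-- **(2.31) ∧ (2.34) for the printed `Δ_a`, under POSITIVITY of `Δ_a` alone** (*"The only assumption we have used was the
positivity of the operator Δ_a, a > 0, or G"*, p. 228): as `eq231_234_deltaA` with `Z ≠ 0` discharged by
`…B6Eq230GaussianRoute.Z_pos` from `⟨A,Δ_aA⟩ ≥ γ‖A‖²`, `γ > 0`. [cite: Balaban1984PropagatorsII, (2.31)–(2.34) pp.227–228] -/
theorem eq231_234_deltaA_of_pos (μA : Measure A) [μA.IsAddHaarMeasure] (lap G : A →ₗ[ℝ] A) (curl : A →ₗ[ℝ] T)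
    (curlAdj : T →ₗ[ℝ] A) (d : V →ₗ[ℝ] A) (dstar : A →ₗ[ℝ] V) (Rp P : V →ₗ[ℝ] V) (Q : A →ₗ[ℝ] W) (Qs : W →ₗ[ℝ] A)
    (a : W →ₗ[ℝ] W) (D : N →ₗ[ℝ] V) (dN : N →ₗ[ℝ] A) (K : Submodule ℝ V) [K.HasOrthogonalProjection]
    (hK : LinearMap.range D = K) (hR : ∀ g, Rp g = K.starProjection g)
    (hlap : lap = curlAdj ∘ₗ curl + d ∘ₗ dstar) (hP : P = LinearMap.id - Rp)
    (hcurlAdj : ∀ (t : T) (v : A), ⟪curlAdj t, v⟫_ℝ = ⟪t, curl v⟫_ℝ)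
    (hadj : ∀ (v : A) (g : V), ⟪v, d g⟫_ℝ = ⟪dstar v, g⟫_ℝ) (hQadj : ∀ (w : W) (v : A), ⟪Qs w, v⟫_ℝ = ⟪w, Q v⟫_ℝ)
    (ha : ∀ w w' : W, ⟪a w, w'⟫_ℝ = ⟪w, a w'⟫_ℝ)
    (hG : B6SectA.deltaA lap d dstar P Q Qs a ∘ₗ G = LinearMap.id)
    (hcurl : ∀ l, curl (dN l) = 0) (hQ : ∀ l, Q (dN l) = 0) (hD : ∀ l, dstar (dN l) = D l)
    (hDinj : Function.Injective D) {γ : ℝ} (hγ : 0 < γ)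
    (hpos : ∀ v, γ * ‖v‖ ^ 2 ≤ ⟪v, B6SectA.deltaA lap d dstar P Q Qs a v⟫_ℝ) :
    Rp ∘ₗ dstar ∘ₗ G ∘ₗ d ∘ₗ Rp = Rp ∧ Rp ∘ₗ dstar ∘ₗ G ∘ₗ Qs = 0 ∧ Q ∘ₗ G ∘ₗ d ∘ₗ Rp = 0 :=
  eq231_234_deltaA μA lap G curl curlAdj d dstar Rp P Q Qs a D dN K hK hR hlap hP hcurlAdj hadj hQadj ha hG hcurl hQ
    hD hDinj (Z_pos μA (B6SectA.deltaA lap d dstar P Q Qs a) hγ hpos).2.ne'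

end DeltaA

end Literature.MathematicalPhysics.QuantumFieldTheory.Balaban1983to89.B6Eq233GaussianRoute

end
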